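import Literature.Combinatorics.Enumerative.DombNumbers
import Literature.Analysis.ODE.RecursiveSeries
import HarnessLib

/-!
# The Domb series `y₀(z) = Σ D_k z^k` and the Picard–Fuchs equation `B₄ · y₀ = 0`

The generating series `y₀(z) = Σ_{k ≥ 0} W₄(2k) z^k` of the Domb numbers
(`Literature.Combinatorics.Enumerative.domb`) "converges for `|z| < 1/16`" and "satisfies the
differential equation `B₄ · y₀(z) = 0` where
`B₄ = 64z²(θ+1)³ − 2z(2θ+1)(5θ²+5θ+2) + θ³` and `θ = z d/dz`" [BorweinEtAl2012, §4 Remark 6]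
— the analytic solution at `0` of the (rescaled) Picard–Fuchs equation `A₄` of the four-step
density `p₄`, whose modular parametrisation (Chan–Zudilin) is the engine of
[BorweinEtAl2012, Thm. 9]. This file PROVES both statements:

* `domb_le_sixteen_pow` — `D_k ≤ 16^k` (so the radius of convergence is at least `1/16`);
* `Literature.Analysis.ODE.dombTheta m z = Σ_k k^m D_k z^k` (`m = 0` is `y₀`), holomorphic on
  `‖z‖ < 1/16`, with `θ(dombTheta m) = dombTheta (m+1)` there (`hasDerivAt_dombTheta`,
  `mul_deriv_dombTheta`);
* `dombSeries_picardFuchs` — **`B₄ · y₀ = 0` on `‖z‖ < 1/16`**, i.e.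
  `64z²(θ³y₀ + 3θ²y₀ + 3θy₀ + y₀) − 2z(10θ³y₀ + 15θ²y₀ + 9θy₀ + 2y₀) + θ³y₀ = 0`
  (`(2θ+1)(5θ²+5θ+2) = 10θ³+15θ²+9θ+2`), coefficientwise the Domb recurrence
  `Literature.Combinatorics.Enumerative.domb_recurrence`.

The series calculus is the tree's `Literature.Analysis.ODE.cseries` (unit disc, polynomially
bounded coefficients, term-wise differentiation) in the variable `x = 16z`.

## References

* [BorweinEtAl2012] J. M. Borwein, A. Straub, J. Wan, W. Zudilin, *Densities of short uniform
  random walks*, Canad. J. Math. 64 (2012) 961–990 (arXiv:1103.2995), §4 Remark 6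
  (eqs. for `y₀`, `B₄`).
-/

noncomputable section

open Finset Filter Topology
open Literature.Combinatorics.Enumerative

namespace Literature.Analysis.ODE

/-! ### Growth: `D_k ≤ 16^k` -/

/-- `Σ fᵢ² ≤ (Σ fᵢ)²` in `ℕ`. [folklore] -/
theorem sum_sq_le_sq_sum (s : Finset ℕ) (f : ℕ → ℕ) :
    ∑ i ∈ s, f i ^ 2 ≤ (∑ i ∈ s, f i) ^ 2 := by
  calc ∑ i ∈ s, f i ^ 2 = ∑ i ∈ s, f i * f i := Finset.sum_congr rfl fun i _ => sq (f i)
    _ ≤ ∑ i ∈ s, f i * ∑ j ∈ s, f j :=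
        Finset.sum_le_sum fun i hi =>
          Nat.mul_le_mul_left _ (Finset.single_le_sum (fun _ _ => Nat.zero_le _) hi)
    _ = (∑ i ∈ s, f i) ^ 2 := by rw [← Finset.sum_mul, sq]

/-- `W₃(2j) = Σ_i C(j,i)² C(2i,i) ≤ 9^j` (indeed `= E|S₃|^{2j} ≤ 3^{2j}`; here combinatorially:
`C(2i,i) ≤ 4^i` and `Σ (C(j,i)2^i)² ≤ (Σ C(j,i)2^i)² = 9^j`). [folklore] -/
theorem threeStepMoment_le_nine_pow (j : ℕ) : threeStepMoment j ≤ 9 ^ j := by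
  have h3 : ∑ i ∈ range (j + 1), j.choose i * 2 ^ i = 3 ^ j := by
    have := (add_pow (2 : ℕ) 1 j).symm
    simpa [mul_comm] using this
  calc threeStepMoment j = ∑ i ∈ range (j + 1), j.choose i ^ 2 * (2 * i).choose i := rfl
    _ ≤ ∑ i ∈ range (j + 1), (j.choose i * 2 ^ i) ^ 2 := by
        refine Finset.sum_le_sum fun i _ => ?_
        have h4 : (2 * i).choose i ≤ 4 ^ i := by
          calc (2 * i).choose i ≤ 2 ^ (2 * i) := Nat.choose_le_two_pow _ _
            _ = 4 ^ i := by rw [pow_mul]; norm_num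
        calc j.choose i ^ 2 * (2 * i).choose i ≤ j.choose i ^ 2 * 4 ^ i :=
              Nat.mul_le_mul_left _ h4
          _ = (j.choose i * 2 ^ i) ^ 2 := by
              rw [mul_pow, ← pow_mul, show (4 : ℕ) = 2 ^ 2 by norm_num, ← pow_mul, mul_comm 2 i]
    _ ≤ (∑ i ∈ range (j + 1), j.choose i * 2 ^ i) ^ 2 := sum_sq_le_sq_sum _ _
    _ = 9 ^ j := by rw [h3, ← pow_mul, show (3 : ℕ) ^ (j * 2) = 9 ^ j by rw [mul_comm, pow_mul]; norm_num]

/-- **`D_k ≤ 16^k`** (indeed `D_k = E|S₄|^{2k} ≤ 4^{2k}`; here combinatorially from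
`W₃(2j) ≤ 9^j` and `Σ (C(k,j)3^j)² ≤ (Σ C(k,j)3^j)² = 16^k`): the Domb series converges for
`|z| < 1/16`. [cite: BorweinEtAl2012, §4 Remark 6] -/
theorem domb_le_sixteen_pow (k : ℕ) : domb k ≤ 16 ^ k := by
  have h4 : ∑ j ∈ range (k + 1), k.choose j * 3 ^ j = 4 ^ k := by
    have := (add_pow (3 : ℕ) 1 k).symm
    simpa [mul_comm] using this
  calc domb k = ∑ j ∈ range (k + 1), k.choose j ^ 2 * threeStepMoment j := rfl
    _ ≤ ∑ j ∈ range (k + 1), (k.choose j * 3 ^ j) ^ 2 := by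
        refine Finset.sum_le_sum fun j _ => ?_
        calc k.choose j ^ 2 * threeStepMoment j ≤ k.choose j ^ 2 * 9 ^ j :=
              Nat.mul_le_mul_left _ (threeStepMoment_le_nine_pow j)
          _ = (k.choose j * 3 ^ j) ^ 2 := by
              rw [mul_pow, ← pow_mul, show (9 : ℕ) = 3 ^ 2 by norm_num, ← pow_mul, mul_comm 2 j]
    _ ≤ (∑ j ∈ range (k + 1), k.choose j * 3 ^ j) ^ 2 := sum_sq_le_sq_sum _ _
    _ = 16 ^ k := by rw [h4, ← pow_mul, show (4 : ℕ) ^ (k * 2) = 16 ^ k by rw [mul_comm, pow_mul]; norm_num]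

/-! ### The coefficient sequences `k^m D_k / 16^k` -/

/-- The normalised coefficients `a^{(m)}_k = k^m D_k / 16^k` (so that `Σ a^{(m)}_k x^k`,
`x = 16z`, is `θ^m y₀`). [folklore] -/
def dombCoeff (m : ℕ) (k : ℕ) : ℂ := (k : ℂ) ^ m * ((domb k : ℂ) / 16 ^ k)

/-- `|a^{(m)}_k| ≤ (k+1)^m`: the coefficients are polynomially bounded. [folklore] -/
theorem polyBounded_dombCoeff (m : ℕ) : PolyBounded (dombCoeff m) := by
  refine ⟨1, m, fun k => ?_⟩
  have h16 : (0 : ℝ) < 16 ^ k := by positivity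
  have hd : ((domb k : ℂ) / 16 ^ k : ℂ) = (((domb k : ℝ) / 16 ^ k : ℝ) : ℂ) := by push_cast; ring
  have hle : (domb k : ℝ) / 16 ^ k ≤ 1 := by
    rw [div_le_one h16]
    exact_mod_cast domb_le_sixteen_pow k
  have hge : 0 ≤ (domb k : ℝ) / 16 ^ k := by positivity
  rw [dombCoeff, norm_mul, norm_pow, Complex.norm_natCast, hd, Complex.norm_real,
    Real.norm_of_nonneg hge, one_mul]
  calc (k : ℝ) ^ m * ((domb k : ℝ) / 16 ^ k) ≤ (k : ℝ) ^ m * 1 :=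
        mul_le_mul_of_nonneg_left hle (by positivity)
    _ ≤ ((k : ℝ) + 1) ^ m := by
        rw [mul_one]; exact pow_le_pow_left₀ (by positivity) (by linarith) m

/-- `θ` on coefficients: `S (D a^{(m)}) = a^{(m+1)}` (`x · d/dx` multiplies the `k`-th
coefficient by `k`). [folklore] -/
theorem shiftSeq_dSeq_dombCoeff (m : ℕ) : shiftSeq (dSeq (dombCoeff m)) = dombCoeff (m + 1) := by
  funext k
  cases k with
  | zero => simp [dombCoeff]
  | succ n =>
    rw [shiftSeq_succ, dSeq_apply, dombCoeff, dombCoeff]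
    push_cast
    ring

/-! ### The functions `θ^m y₀` -/

/-- **`θ^m y₀(z) = Σ_k k^m D_k z^k`** (`m = 0`: the Domb series `y₀`), defined through the unit-disc
series calculus in `x = 16z`. [cite: BorweinEtAl2012, §4 Remark 6] -/
def dombTheta (m : ℕ) (z : ℂ) : ℂ := cseries (dombCoeff m) (16 * z)

/-- The Domb series `y₀(z) = Σ D_k z^k`. [cite: BorweinEtAl2012, §4 Remark 6] -/
abbrev dombSeries : ℂ → ℂ := dombTheta 0

/-- `‖16 z‖ < 1` for `‖z‖ < 1/16`. [folklore] -/
theorem norm_sixteen_mul_lt {z : ℂ} (hz : ‖z‖ < 1 / 16) : ‖(16 : ℂ) * z‖ < 1 := by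
  rw [norm_mul]
  have : ‖(16 : ℂ)‖ = 16 := by simp
  rw [this]
  linarith

/-- **Series form**: `θ^m y₀(z) = Σ_k k^m D_k z^k` for `‖z‖ < 1/16` (absolutely convergent).
[cite: BorweinEtAl2012, §4 Remark 6] -/
theorem hasSum_dombTheta (m : ℕ) {z : ℂ} (hz : ‖z‖ < 1 / 16) :
    HasSum (fun k : ℕ => (k : ℂ) ^ m * (domb k : ℂ) * z ^ k) (dombTheta m z) := by
  have h := hasSum_cseries (polyBounded_dombCoeff m) (norm_sixteen_mul_lt hz)
  have hfun : (fun k : ℕ => dombCoeff m k * (16 * z) ^ k) =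
      fun k : ℕ => (k : ℂ) ^ m * (domb k : ℂ) * z ^ k := by
    funext k
    have h16 : (16 : ℂ) ^ k ≠ 0 := pow_ne_zero _ (by norm_num)
    rw [dombCoeff, mul_pow]
    field_simp
  rw [hfun] at h
  exact h

/-- `y₀(z) = Σ D_k z^k`. [cite: BorweinEtAl2012, §4 Remark 6] -/
theorem hasSum_dombSeries {z : ℂ} (hz : ‖z‖ < 1 / 16) :
    HasSum (fun k : ℕ => (domb k : ℂ) * z ^ k) (dombSeries z) := by
  simpa using hasSum_dombTheta 0 hz

/-- `y₀(0) = 1`. [folklore] -/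
theorem dombSeries_zero : dombSeries 0 = 1 := by
  simp [dombSeries, dombTheta, cseries_zero_right, dombCoeff, domb_zero]

/-- **Term-wise differentiation**: `d/dz θ^m y₀ = 16 · Σ (D a^{(m)})_k (16z)^k` on `‖z‖ < 1/16`.
[folklore] -/
theorem hasDerivAt_dombTheta (m : ℕ) {z : ℂ} (hz : ‖z‖ < 1 / 16) :
    HasDerivAt (dombTheta m) (16 * cseries (dSeq (dombCoeff m)) (16 * z)) z := by
  have h := hasDerivAt_cseries (polyBounded_dombCoeff m) (norm_sixteen_mul_lt hz)
  have hlin : HasDerivAt (fun z : ℂ => (16 : ℂ) * z) 16 z := by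
    simpa using (hasDerivAt_id z).const_mul (16 : ℂ)
  have h2 : HasDerivAt (fun w : ℂ => cseries (dombCoeff m) (16 * w))
      (cseries (dSeq (dombCoeff m)) (16 * z) * 16) z := h.comp z hlin
  exact h2.congr_deriv (by ring)

/-- `θ^m y₀` is holomorphic on `‖z‖ < 1/16`. [cite: BorweinEtAl2012, §4 Remark 6] -/
theorem differentiableAt_dombTheta (m : ℕ) {z : ℂ} (hz : ‖z‖ < 1 / 16) :
    DifferentiableAt ℂ (dombTheta m) z :=
  (hasDerivAt_dombTheta m hz).differentiableAt

/-- **The Euler operator**: `z · (θ^m y₀)'(z) = θ^{m+1} y₀(z)` on `‖z‖ < 1/16`. [folklore] -/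
theorem mul_deriv_dombTheta (m : ℕ) {z : ℂ} (hz : ‖z‖ < 1 / 16) :
    z * deriv (dombTheta m) z = dombTheta (m + 1) z := by
  rw [(hasDerivAt_dombTheta m hz).deriv, dombTheta, ← shiftSeq_dSeq_dombCoeff,
    cseries_shiftSeq (polyBounded_dombCoeff m).dSeq (norm_sixteen_mul_lt hz)]
  ring

/-! ### The Picard–Fuchs equation `B₄ · y₀ = 0` -/

/-- The coefficient sequence of `B₄ y₀` in `x = 16z`:
`¼ S²(a⁽³⁾+3a⁽²⁾+3a⁽¹⁾+a⁽⁰⁾) − ⅛ S(10a⁽³⁾+15a⁽²⁾+9a⁽¹⁾+2a⁽⁰⁾) + a⁽³⁾`. [folklore] -/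
def dombPFCoeff (k : ℕ) : ℂ :=
  (1 / 4 : ℂ) * shiftSeq (shiftSeq fun j => dombCoeff 3 j + 3 * dombCoeff 2 j + 3 * dombCoeff 1 j +
      dombCoeff 0 j) k -
    (1 / 8 : ℂ) * shiftSeq (fun j => 10 * dombCoeff 3 j + 15 * dombCoeff 2 j + 9 * dombCoeff 1 j +
      2 * dombCoeff 0 j) k +
    dombCoeff 3 k

/-- **Every coefficient of `B₄ y₀` vanishes** — the Domb recurrence. [cite: BorweinEtAl2012, §4 Remark 6] -/
theorem dombPFCoeff_eq_zero (k : ℕ) : dombPFCoeff k = 0 := by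
  rcases k with _ | _ | n
  · simp [dombPFCoeff, dombCoeff]
  · simp [dombPFCoeff, dombCoeff, domb_zero, domb_one]
    norm_num
  · -- k = n + 2: the recurrence at n + 1
    have hrec := domb_recurrence (k := n + 1) (by omega)
    rw [Nat.add_sub_cancel] at hrec
    have hrecC : ((n : ℂ) + 1 + 1) ^ 3 * (domb (n + 1 + 1) : ℂ) + 64 * ((n : ℂ) + 1) ^ 3 * (domb n : ℂ)
        = 2 * (2 * ((n : ℂ) + 1) + 1) * (5 * ((n : ℂ) + 1) ^ 2 + 5 * ((n : ℂ) + 1) + 2) *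
            (domb (n + 1) : ℂ) := by
      exact_mod_cast hrec
    simp only [dombPFCoeff, shiftSeq_succ, dombCoeff]
    push_cast
    linear_combination (1 / (16 : ℂ) ^ (n + 1 + 1)) * hrecC

/-- **The Picard–Fuchs equation of the Domb series** [BorweinEtAl2012, §4 Remark 6]:
on `‖z‖ < 1/16`, with `θ = z d/dz` realised by `dombTheta` (`mul_deriv_dombTheta`),
`B₄ · y₀ = 64z²(θ+1)³y₀ − 2z(2θ+1)(5θ²+5θ+2)y₀ + θ³y₀ = 0`, written out with
`(θ+1)³ = θ³+3θ²+3θ+1` and `(2θ+1)(5θ²+5θ+2) = 10θ³+15θ²+9θ+2`.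
[cite: BorweinEtAl2012, §4 Remark 6 (operator B₄)] -/
theorem dombSeries_picardFuchs {z : ℂ} (hz : ‖z‖ < 1 / 16) :
    64 * z ^ 2 * (dombTheta 3 z + 3 * dombTheta 2 z + 3 * dombTheta 1 z + dombTheta 0 z) -
      2 * z * (10 * dombTheta 3 z + 15 * dombTheta 2 z + 9 * dombTheta 1 z + 2 * dombTheta 0 z) +
        dombTheta 3 z = 0 := by
  set x : ℂ := 16 * z with hx
  have hx1 : ‖x‖ < 1 := norm_sixteen_mul_lt hz
  have hP := polyBounded_dombCoeff
  -- the two bracket sequences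
  set b₁ : ℕ → ℂ := fun j => dombCoeff 3 j + 3 * dombCoeff 2 j + 3 * dombCoeff 1 j + dombCoeff 0 j
    with hb₁
  set b₂ : ℕ → ℂ := fun j => 10 * dombCoeff 3 j + 15 * dombCoeff 2 j + 9 * dombCoeff 1 j +
    2 * dombCoeff 0 j with hb₂
  have hPb₁ : PolyBounded b₁ :=
    (((hP 3).add ((hP 2).const_mul 3)).add ((hP 1).const_mul 3)).add (hP 0)
  have hPb₂ : PolyBounded b₂ :=
    ((((hP 3).const_mul 10).add ((hP 2).const_mul 15)).add ((hP 1).const_mul 9)).add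
      ((hP 0).const_mul 2)
  have hB₁ : cseries b₁ x = dombTheta 3 z + 3 * dombTheta 2 z + 3 * dombTheta 1 z + dombTheta 0 z := by
    simp only [hb₁, dombTheta, ← hx]
    rw [cseries_add (((hP 3).add ((hP 2).const_mul 3)).add ((hP 1).const_mul 3)) (hP 0) hx1,
      cseries_add ((hP 3).add ((hP 2).const_mul 3)) ((hP 1).const_mul 3) hx1,
      cseries_add (hP 3) ((hP 2).const_mul 3) hx1, cseries_const_mul, cseries_const_mul]
  have hB₂ : cseries b₂ x =
      10 * dombTheta 3 z + 15 * dombTheta 2 z + 9 * dombTheta 1 z + 2 * dombTheta 0 z := by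
    simp only [hb₂, dombTheta, ← hx]
    rw [cseries_add ((((hP 3).const_mul 10).add ((hP 2).const_mul 15)).add ((hP 1).const_mul 9))
        ((hP 0).const_mul 2) hx1,
      cseries_add (((hP 3).const_mul 10).add ((hP 2).const_mul 15)) ((hP 1).const_mul 9) hx1,
      cseries_add ((hP 3).const_mul 10) ((hP 2).const_mul 15) hx1, cseries_const_mul,
      cseries_const_mul, cseries_const_mul, cseries_const_mul]
  -- multiplication by `x²` and `x` as shifts
  have hS₁ : cseries (shiftSeq (shiftSeq b₁)) x = x ^ 2 * cseries b₁ x := by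
    rw [cseries_shiftSeq hPb₁.shift hx1, cseries_shiftSeq hPb₁ hx1]; ring
  have hS₂ : cseries (shiftSeq b₂) x = x * cseries b₂ x := cseries_shiftSeq hPb₂ hx1
  -- the full combination is the series of `dombPFCoeff = 0`
  have hsum : cseries dombPFCoeff x =
      (1 / 4 : ℂ) * cseries (shiftSeq (shiftSeq b₁)) x - (1 / 8 : ℂ) * cseries (shiftSeq b₂) x +
        cseries (dombCoeff 3) x := by
    have e : ∀ k, dombPFCoeff k =
        ((1 / 4 : ℂ) * shiftSeq (shiftSeq b₁) k - (1 / 8 : ℂ) * shiftSeq b₂ k) + dombCoeff 3 k :=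
      fun k => rfl
    rw [cseries_congr e, cseries_add ((hPb₁.shift.shift.const_mul _).sub (hPb₂.shift.const_mul _))
      (hP 3) hx1, cseries_sub (hPb₁.shift.shift.const_mul _) (hPb₂.shift.const_mul _) hx1,
      cseries_const_mul, cseries_const_mul]
  have hzero : cseries dombPFCoeff x = 0 := cseries_eq_zero dombPFCoeff_eq_zero x
  rw [hsum, hS₁, hS₂, hB₁, hB₂] at hzero
  have h3 : cseries (dombCoeff 3) x = dombTheta 3 z := rfl
  rw [h3, hx] at hzero
  linear_combination hzero

end Literature.Analysis.ODE

end
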